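import Literature.Analysis.FluidPDE.QuasiSelfSimilarMoveSP11Checks1
import Literature.Analysis.FluidPDE.QuasiSelfSimilarMoveSP11Checks2
import Literature.Analysis.FluidPDE.QuasiSelfSimilarMoveSC
import HarnessLib

/-!
# Straight move, phase 11: assembled checks and the slot

Topic `Literature/Analysis/FluidPDE`. Emitted data / kernel certificates of the explicit straight generating
move (`S`) in the typed-chain model, under the contract of `PlanarGeneratorAssembly.lean`
(`acm_compatible_blocks_of_slots`). Generated by the author's emitter from the exact rational design;
no named facts, every theorem is decided in the kernel or assembled from decided chunks. [folklore]

## References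

* G. Alberti, G. Crippa, A. L. Mazzucato, *Exponential self-similar mixing by incompressible
  flows*, J. Amer. Math. Soc. 32 (2019), 445–490, §8 (arXiv:1605.02090).
-/

noncomputable section

namespace Literature.Analysis.FluidPDE.QuasiSelfSimilar.MoveS

open PlanarKinematics QuasiSelfSimilar

set_option maxHeartbeats 4000000 in
/-- Node count. [folklore] -/
theorem P11_K : P11.K = 85 := by decide +kernel

/-- Kernel check of element validity (all nodes). [folklore] -/
theorem P11_valid : ∀ k < 85, (P11.node k).e.validB = true :=
  (forall_lt_of_chunk (forall_lt_of_chunk (forall_lt_of_chunk (forall_lt_zero fun k => (P11.node k).e.validB = true) P11_valid_c0) P11_valid_c1) P11_valid_c2)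

/-- Kernel check of positivity (all nodes). [folklore] -/
theorem P11_pos : ∀ k < 85, (decide (0 < (P11.node k).box.ρ) && decide (0 < (P11.node k).step.len)) = true :=
  (forall_lt_of_chunk (forall_lt_of_chunk (forall_lt_of_chunk (forall_lt_zero fun k => (decide (0 < (P11.node k).box.ρ) && decide (0 < (P11.node k).step.len)) = true) P11_pos_c0) P11_pos_c1) P11_pos_c2)

/-- Kernel check of the node geometry (orders, pieces, cover tags) (all nodes). [folklore] -/
theorem P11_geo : ∀ k < 85, P11.geomAtB k = true :=
  (forall_lt_of_chunk (forall_lt_of_chunk (forall_lt_of_chunk (forall_lt_zero fun k => P11.geomAtB k = true) P11_geo_c0) P11_geo_c1) P11_geo_c2)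

/-- Kernel check of box separation rows (all nodes). [folklore] -/
theorem P11_sep : ∀ k < 85, P11.sepRowB k = true :=
  (forall_lt_of_chunk (forall_lt_of_chunk (forall_lt_of_chunk (forall_lt_zero fun k => P11.sepRowB k = true) P11_sep_c0) P11_sep_c1) P11_sep_c2)

/-- Kernel check of junction agreement (all nodes). [folklore] -/
theorem P11_agr : ∀ k < 85, P11.agreeAtB k = true :=
  (forall_lt_of_chunk (forall_lt_of_chunk (forall_lt_of_chunk (forall_lt_zero fun k => P11.agreeAtB k = true) P11_agr_c0) P11_agr_c1) P11_agr_c2)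

/-- `elemsValidB` of phase 11. [folklore] -/
theorem P11_elemsValidB : P11.elemsValidB = true :=
  PhaseQ.elemsValidB_of_forall (by decide +kernel) (by rw [P11_K]; exact P11_valid)

/-- `allPosB` of phase 11. [folklore] -/
theorem P11_allPosB : P11.allPosB = true :=
  PhaseQ.allPosB_of_forall (by rw [P11_K]; exact P11_pos)

/-- `geomB` of phase 11. [folklore] -/
theorem P11_geomB : P11.geomB = true :=
  PhaseQ.geomB_of_geomAtB P11_elemsValidB P11_allPosB (by rw [P11_K]; exact P11_geo)

/-- `boxSepB` of phase 11. [folklore] -/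
theorem P11_boxSepB : P11.boxSepB = true :=
  PhaseQ.boxSepB_of_sepRowB (by rw [P11_K]; exact P11_sep)

/-- `agreeB` of phase 11. [folklore] -/
theorem P11_agreeB : P11.agreeB = true :=
  PhaseQ.agreeB_of_agreeAtB (by rw [P11_K]; exact P11_agr)

set_option maxHeartbeats 4000000 in
/-- `gateOKB` of phase 11 on its slot. [folklore] -/
theorem P11_gateOKB : P11.gateOKB C_S stub11 (mkRat (11) 15) = true := by decide +kernel

/-- Slot 11 of the straight move. [folklore] -/
def slot11 : Slot := ⟨P11, (mkRat (11) 15), stub11, rc11, rc11'⟩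
/-- Slot test of slot 11. [folklore] -/
theorem slot11_okB : slot11.okB C_S (genGate .S) (mkRat (3) 200) = true :=
  Slot.okB_intro (s := slot11) P11_geomB P11_boxSepB P11_agreeB P11_gateOKB rfl (by decide)

end Literature.Analysis.FluidPDE.QuasiSelfSimilar.MoveS

end
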